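import Literature.MathematicalPhysics.KineticTheory.LangevinChainGibbs
import Literature.MathematicalPhysics.KineticTheory.LangevinChainConfined
import Literature.MathematicalPhysics.KineticTheory.SdeGeneratorCalculus
import Mathlib.Analysis.SpecialFunctions.Log.Basic
import HarnessLib

/-!
# Barrier (AtomisticToContinuum / FouriersLaw): boundary taps cannot drain an extensive norm in bounded time — norm persistence for EVERY extensive observable

`Literature/Barriers/AtomisticToContinuum` (D-0021 catalogue), sub-problem `FouriersLaw`; definition
request `defn-BoundaryTapNormPersistence` (planner lens `barrier-inversion`, 2026-08-17). This entry
unifies two earlier findings into ONE typed wall: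
* the even-sector companion entry `SpectralGapClosingEquilibrium.equilibrium_rate_bound` (observable
  `g = H_N`: the centred energy moves by at most `2γT·t` in `L²(μ_T)`, so no `N`-uniform rate), and
* the odd-sector refutation of the support item `OddCorrectorDecay` of route `OddSectorIrreversibility`
  (observable `g = J_tot = ∑_i j_i`: `Summit.AtomisticToContinuum.FouriersLaw.Theorems.not_OddCorrectorDecay`,
  through bath locality `OddCorrectorBathLocality.bathLocality` and odd persistence of the closed chain).
Both are instances of the same mechanism, valid for momentum-even and momentum-odd observables alike:
for the chain `P` (any `OscillatorChain`; the conjunct's `pinnedChain ω₂ lam β γ`) with Langevin baths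
at the SAME temperature `T` on the two end momenta, `μ_T = e^{-H_N/T} dq dp` and `P_t = e^{tL}`,

1. TAP DISSIPATION IDENTITY. The carré du champ of the two-bath generator lives on the two thermostatted
   momenta only: `L(f²) - 2 f Lf = 2γ (T_L (∂_{p_0} f)² + T_R (∂_{p_{N-1}} f)²)` (PROVED for every chain and
   every `f ∈ C²`: `generator_sq_two_baths`), hence at `T_L = T_R = T`, by `∫ L(f²) e^{-H/T} = 0`
   (`OscillatorChain.integral_generator_mul_gibbsDensity`),
   `⟨f, Lf⟩_{L²(μ_T)} = -γT (‖∂_{p_0} f‖² + ‖∂_{p_{N-1}} f‖²)` for `f ∈ C²_c` (PROVED: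
   `integral_mul_generator_gibbsDensity_two_baths`) — the infinitesimal form of
   `‖g‖² - ‖P_t g‖² = 2γT ∫₀ᵗ ∑_{b ∈ {0, N-1}} ‖∂_{p_b} P_s g‖² ds`: dissipation acts on `2` of the `2N`
   directions, the bulk Liouville evolution is `L²(μ_T)`-isometric [cite: BakryGentilLedoux2014, §1.4.2 Def. 1.4.2 and §1.6 eq. (1.6.3)].
2. TAP LOCALITY (the dictionary input, NOT formalised here). For an extensive observable
   `g_N = ∑_x τ_x g₀` (translation sum of one smooth local observable) the sensitivity of the forecast
   `P_s g_N` to a boundary momentum is carried by the sites a perturbation reaches within time `s`, so the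
   dissipated norm by time `t` is `≤ K(t, g₀)·Z_N` (`Z_N` the Gibbs mass) with `K` independent of `N` —
   finite propagation speed of perturbations in oscillator lattices: `|i-j| > ct` for harmonic or bounded
   forces and `|i-j| > t^{4/3}` for anharmonic systems at thermal equilibrium [cite: MarchioroEtAl1978]
   (as restated in [cite: ButtaEtAl2007, §1]), `|i-j| > t log^α t` for quartic pinning with harmonic
   coupling [cite: ButtaEtAl2007, Thm 2.2]; for `g₀ = j_0` and the conjunct's chain the fixed-time
   statement is PROVED on the summit side (`OddCorrectorBathLocality.bathLocality`).
3. NORM PERSISTENCE. With `M_N = ‖g_N‖² ≥ c N Z_N` (extensivity of the variance), 1 + 2 give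
   `‖P_t g_N‖² / ‖g_N‖² ≥ 1 - K(t)/(cN) → 1` at every fixed `t` (PROVED in the abstract:
   `BoundaryTapNormPersistence.of_dissipation_le`); the even-sector route to the same conclusion
   (`‖P_t f - f‖ ≤ v t`, `‖f_N‖ ≥ σ√N`) is `BoundaryTapNormPersistence.of_slow`.

The WALL is the predicate `BoundaryTapNormPersistence M A` on the scalar data `M_N = ‖g_N‖²`,
`A_N(t) = ‖P_t g_N‖²` (centred observables; the same Bochner integrals as
`OddSectorLocality.currentNormSq` / `forecastNormSq` for `g = J_tot`), and what it BLOCKS is proved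
about the predicate: no `N`-uniform exponential norm decay (`not_exp_decay`), and every `N`-uniform
weighted time-integrated norm bound `∫₀^∞ w(t) ‖P_t g_N‖ dt ≤ C ‖g_N‖` forces `∫₀^S w ≤ 2C` for all `S`
(`weightMass_le`), in particular none with `w ≡ 1` (`not_L1_decay`, the shape of `OddCorrectorDecay`).
This is the classical `L²` form of the transport bound for boundary-dissipated chains — "relaxation can
not happen in a time that grows with `L` slower than linearly … a 'disturbance' at that site can not
dissipate in a time smaller than `∝ L`, i.e., the time a disturbance needs to get to a site with
dissipation" [cite: Znidaric2015, §IV.A].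

## Contents (everything PROVED; no named fact; the locality input 2 enters as a hypothesis)

* `generator_sq_two_baths`, `integral_mul_generator_gibbsDensity_two_baths` — the mechanism (1).
* `BoundaryTapNormPersistence` — the wall (3) as a predicate; carries the BARRIER block.
* `BoundaryTapNormPersistence.of_dissipation_le` (1 + 2 ⟹ 3), `.of_slow` (even sector).
* `BoundaryTapNormPersistence.not_exp_decay`, `.weightMass_le_core`, `.weightMass_le`, `.not_L1_decay`;
  the packaged no-go statements `BoundaryTapNormPersistence.barrier` / `.barrier_L1` (1 + 2 ⟹ no uniform decay).

## Design notes

As in `SpectralGapClosingEquilibrium.lean`, the semigroup dictionary (Gibbs invariance of the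
constructed kernels, `P_t g ∈ Dom(L)`, the backward equation turning (1) into its integrated form,
contractivity `t ↦ A_N(t)` non-increasing) and the propagation estimate (2) are quoted, not formalised:
the Lean theorems are the generator identity on which (1) rests and the real-analysis implications,
with the dictionary's outputs as hypotheses. Deliberately NOT here: a Lean definition of "translation
sum of a local observable" (no requester needs it yet), the non-equilibrium case `T_L ≠ T_R`, and any
statement about the conductivity `κ` — the wall constrains norms of forecasts, not Green–Kubo integrals.
-/

noncomputable section

open MeasureTheory Set Filter Topology Literature.MathematicalPhysics.KineticTheory
open Literature.MathematicalPhysics.KineticTheory.HeatConduction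

namespace Literature.Barriers.AtomisticToContinuum

/-! ### A. The mechanism: the carré du champ of the two-bath generator lives on the two taps -/

section Mechanism

variable {N : ℕ}

/-- **Carré du champ of the Langevin-chain generator.** For every chain `P` (any pinning `U`,
coupling `V`, friction `γ`), `N ≥ 1`, bath temperatures with `γT_L, γT_R ≥ 0`, and every `f ∈ C²`:
`L(f²) = 2 f Lf + 2γ (T_L (∂_{p_0} f)² + T_R (∂_{p_{N-1}} f)²)`, i.e. `Γ(f, f) = ½(L(f²) - 2fLf)`
[cite: BakryGentilLedoux2014, §1.4.2 Def. 1.4.2] charges only the two thermostatted momenta — the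
Liouville part is a derivation and contributes nothing. PROVED from the product rule for the SDE
generator (`sdeGenerator_sq`, `OscillatorChain.sdeGenerator_drift_eq_generator`). (For `N = 1` both
baths sit on the single site and the two terms coincide.) [folklore] -/
theorem generator_sq_two_baths (P : OscillatorChain) (hN : 0 < N) {T_L T_R : ℝ}
    (hL : 0 ≤ P.γ * T_L) (hR : 0 ≤ P.γ * T_R) {f : PhaseSpace N → ℝ} (hf : ContDiff ℝ 2 f)
    (x : PhaseSpace N) :
    P.generator N T_L T_R (fun y => f y ^ 2) x =
      2 * f x * P.generator N T_L T_R f x +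
        2 * P.γ * (T_L * partialP ⟨0, hN⟩ f x ^ 2 +
          T_R * partialP ⟨N - 1, Nat.sub_lt hN one_pos⟩ f x ^ 2) := by
  have hN1 : N - 1 < N := Nat.sub_lt hN one_pos
  have hfd : Differentiable ℝ f := hf.differentiable (by norm_num)
  have h2 : ContDiff ℝ 2 (fun y => f y ^ 2) := hf.pow 2
  rw [← congrFun (P.sdeGenerator_drift_eq_generator hN hL hR h2) x,
    ← congrFun (P.sdeGenerator_drift_eq_generator hN hL hR hf) x,
    sdeGenerator_sq _ _ _ hf, carreDuChamp_self]
  have hp : ∀ i : Fin N, fderiv ℝ f x (unitP i) = partialP i f x := fun i => by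
    rw [partialP_eq_fderiv hfd i, unitP_eq]
  simp only [OscillatorChain.bathVecL, OscillatorChain.bathVecR, bathVec_eq_smul_unitP hN,
    bathVec_eq_smul_unitP hN1, map_smul, smul_eq_mul, hp]
  have h2L : Real.sqrt (2 * P.γ * T_L) ^ 2 = 2 * P.γ * T_L := Real.sq_sqrt (by linarith)
  have h2R : Real.sqrt (2 * P.γ * T_R) ^ 2 = 2 * P.γ * T_R := Real.sq_sqrt (by linarith)
  rw [mul_pow, mul_pow, h2L, h2R]
  ring

/-- **The infinitesimal tap dissipation identity.** For every chain with `C¹` potentials, `N ≥ 1`,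
`γ ≥ 0`, EQUAL bath temperatures `T_L = T_R = T > 0`, and every `f ∈ C²_c`:
`∫ f (Lf) e^{-H/T} dq dp = -γT ∫ ((∂_{p_0} f)² + (∂_{p_{N-1}} f)²) e^{-H/T} dq dp`,
i.e. `⟨f, Lf⟩_{L²(μ_T)} = -∫ Γ(f) dμ_T` with the carré du champ of `generator_sq_two_baths`: the
time-derivative at `t = 0` of `‖P_t f‖²_{L²(μ_T)}` is minus the Fisher-type information of `f` in the
two bath directions ONLY ("`∫ Γ(f, g) dμ = -∫ f Lg dμ` … immediate by integration of the definition of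
`Γ` together with the invariance property `∫ Lf dμ = 0`", here in the diagonal case `f = g`, which uses
invariance alone) [cite: BakryGentilLedoux2014, §1.6 eq. (1.6.3)]. PROVED: `∫ L(f²) e^{-H/T} = 0` at
equal temperatures is `OscillatorChain.integral_generator_mul_gibbsDensity`
[cite: BonettoLebowitzReyBellet2000, §4.1]. [folklore] -/
theorem integral_mul_generator_gibbsDensity_two_baths (P : OscillatorChain) (hU : ContDiff ℝ 1 P.U)
    (hV : ContDiff ℝ 1 P.V) (hN : 0 < N) {T : ℝ} (hT : 0 < T) (hγ : 0 ≤ P.γ)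
    {f : PhaseSpace N → ℝ} (hf : ContDiff ℝ 2 f) (hfc : HasCompactSupport f) :
    ∫ x, f x * P.generator N T T f x * P.gibbsDensity N T x =
      -(P.γ * T) * ∫ x, (partialP ⟨0, hN⟩ f x ^ 2 +
        partialP ⟨N - 1, Nat.sub_lt hN one_pos⟩ f x ^ 2) * P.gibbsDensity N T x := by
  have hN1 : N - 1 < N := Nat.sub_lt hN one_pos
  have hγT : 0 ≤ P.γ * T := mul_nonneg hγ hT.le
  have hfd : Differentiable ℝ f := hf.differentiable (by norm_num)
  have h2 : ContDiff ℝ 2 (fun y => f y ^ 2) := hf.pow 2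
  have h2c : HasCompactSupport (fun y => f y ^ 2) := by
    have : (fun y => f y ^ 2) = f * f := by funext y; simp [sq]
    rw [this]; exact hfc.mul_right
  have h0 : ∫ x, P.generator N T T (fun y => f y ^ 2) x * P.gibbsDensity N T x = 0 := by
    rw [P.integral_generator_mul_gibbsDensity hU hV N T T T h2 h2c]
    simp [div_self hT.ne']
  have hρ : Continuous (P.gibbsDensity N T) :=
    P.continuous_gibbsDensity hU.continuous hV.continuous N T
  have hLc : Continuous (P.generator N T T f) := P.continuous_generator hU hV N T T hf
  have hPc : ∀ i, Continuous (partialP i f) := fun i => continuous_partialP hf (by norm_num) i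
  have hPs : ∀ i, HasCompactSupport (fun x => partialP i f x ^ 2) := fun i => by
    simp_rw [sq]
    exact (hasCompactSupport_partialP hfd hfc i).mul_right
  have hI1 : Integrable (fun x => f x * P.generator N T T f x * P.gibbsDensity N T x) :=
    ((hf.continuous.mul hLc).mul hρ).integrable_of_hasCompactSupport hfc.mul_right.mul_right
  have hI2 : Integrable (fun x => (partialP ⟨0, hN⟩ f x ^ 2 +
      partialP ⟨N - 1, hN1⟩ f x ^ 2) * P.gibbsDensity N T x) :=
    ((((hPc _).pow 2).add ((hPc _).pow 2)).mul hρ).integrable_of_hasCompactSupport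
      ((hPs _).add (hPs _)).mul_right
  have hsplit : (fun x => P.generator N T T (fun y => f y ^ 2) x * P.gibbsDensity N T x) =
      fun x => 2 * (f x * P.generator N T T f x * P.gibbsDensity N T x) +
        2 * (P.γ * T) * ((partialP ⟨0, hN⟩ f x ^ 2 +
          partialP ⟨N - 1, hN1⟩ f x ^ 2) * P.gibbsDensity N T x) := by
    funext x
    rw [generator_sq_two_baths P hN hγT hγT hf x]
    ring
  rw [hsplit, integral_add (hI1.const_mul 2) (hI2.const_mul _), integral_const_mul,
    integral_const_mul] at h0
  linear_combination h0 / 2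

/-- **Bulk observables are infinitesimally norm-preserved.** If `f ∈ C²_c` does not depend on the two
boundary momenta (`∂_{p_0} f = ∂_{p_{N-1}} f = 0`), then `⟨f, Lf⟩_{L²(μ_T)} = 0`: the Liouville part is
antisymmetric and the baths do not see `f`. [folklore] -/
theorem integral_mul_generator_gibbsDensity_eq_zero_of_bulk (P : OscillatorChain)
    (hU : ContDiff ℝ 1 P.U) (hV : ContDiff ℝ 1 P.V) (hN : 0 < N) {T : ℝ} (hT : 0 < T)
    (hγ : 0 ≤ P.γ) {f : PhaseSpace N → ℝ} (hf : ContDiff ℝ 2 f) (hfc : HasCompactSupport f)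
    (h0 : ∀ x, partialP ⟨0, hN⟩ f x = 0)
    (h1 : ∀ x, partialP ⟨N - 1, Nat.sub_lt hN one_pos⟩ f x = 0) :
    ∫ x, f x * P.generator N T T f x * P.gibbsDensity N T x = 0 := by
  rw [integral_mul_generator_gibbsDensity_two_baths P hU hV hN hT hγ hf hfc]
  simp [h0, h1]

end Mechanism

/-! ### B. The wall: norm persistence of an extensive family of observables -/

/-- **Boundary-tap norm persistence** (the typed wall, D-0021). Data: for each length `N`, the squared norm `M_N = ‖g_N‖²_{L²(μ_T)}` of a centred observable of the `N`-site boundary-driven chain at equilibrium and its forecast norms `A_N(t) = ‖P_t g_N‖²_{L²(μ_T)}` (`P_t = e^{tL}`; e.g. `OddSectorLocality.currentNormSq` / `forecastNormSq` for `g = J_tot`). The predicate says: at every FIXED time `t ≥ 0` the forecast keeps asymptotically all of the norm, `A_N(t) ≥ (1 - ε) M_N` for all large `N`, every `ε > 0` — i.e. `‖P_t g_N‖²/‖g_N‖² → 1` (`N → ∞`, `t` fixed). How it ARISES (proved below): from the tap dissipation identity plus tap locality `M_N - A_N(t) ≤ K(t)·Z_N` and extensivity `M_N ≥ c N Z_N`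 (`of_dissipation_le`: momentum-even and -odd `g` alike, e.g. `g = J_tot` via `OddCorrectorBathLocality.bathLocality`), or from a slowly moving orbit `‖P_t f - f‖ ≤ v t`, `‖f_N‖ ≥ σ√N` (`of_slow`: `g = H_N - μ_T(H_N)`, `v = ‖L H_N‖ = 2γT`, the companion entry `equilibrium_rate_bound`). What it BLOCKS (proved below): `not_exp_decay`, `weightMass_le`, `not_L1_decay`; packaged no-go theorems `barrier`, `barrier_L1`.
BARRIER (D-0021), AtomisticToContinuum/FouriersLaw (equilibrium base point `T_L = T_R = T` of the linear response in `OscillatorChain.FouriersLawFor`):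
technique_class: n-uniform-norm-decay hypocoercive-l2-energy-method malliavin-tap-smoothing n-uniform-l1t-forecast-decay n-uniform-relaxation-rate (any estimate `‖P_t g_N - μ_T(g_N)‖ ≤ C e^{-λt} ‖g_N - μ_T(g_N)‖` or `∫₀^∞ w(t) ‖P_t g_N - μ_T(g_N)‖ dt ≤ C ‖g_N - μ_T(g_N)‖`, `∫₀^∞ w = ∞`, with `(λ or w, C)` uniform in `N`, for an EXTENSIVE observable `g_N` of the boundary-driven chain — the norm taken BEFORE the time integration)
blocks: every such estimate for every norm-persistent family: an `N`-uniform `C e^{-λt}` bound forces `λ ≤ 0` (`not_exp_decay`, PROVED), and an `N`-uniform weighted bound forces `∫₀^S w ≤ 2C` for all `S` (`weightMass_le`, PROVED; so `w ∈ L¹` and the estimate is the trivial consequence of contractivity up to the factor `2`), in particular no `∫₀^∞ ‖P_t g_N‖ ≤ C‖g_N‖` (`not_L1_decay`, PROVED — the shape of the refuted support item `OddSectorIrreversibility.OddCorrectorDecay`, `g = J_tot`, `Summit.AtomisticToContinuum.FouriersLaw.Theorems.not_OddCorrectorDecay`); covers the even sector `g = H_N` of `SpectralGapClosingEquilibrium.equilibrium_rate_bound`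 (via `of_slow`) and the odd sector `g = J_tot` (via `of_dissipation_le` and the summit-side bath locality) in one statement [cite: Znidaric2015, §IV.A]
because: the carré du champ of the two-bath generator is `2γ(T_L(∂_{p_0}f)² + T_R(∂_{p_{N-1}}f)²)` — dissipation acts on `2` of the `2N` phase-space directions and the Liouville part is a derivation (`generator_sq_two_baths`, PROVED for every chain), so at `T_L = T_R = T`, where `e^{-H_N/T}` is invariant [cite: BonettoLebowitzReyBellet2000, §4.1], `⟨f, Lf⟩_{L²(μ_T)} = -γT(‖∂_{p_0}f‖² + ‖∂_{p_{N-1}}f‖²)` (`integral_mul_generator_gibbsDensity_two_baths`, PROVED; the diagonal integration by parts [cite: BakryGentilLedoux2014, §1.6 eq. (1.6.3)]), i.e. `‖g‖² - ‖P_t g‖² = 2γT∫₀ᵗ∑_b‖∂_{p_b}P_s g‖²ds` along the semigroup; the sensitivity of `P_s g_N` to a boundary momentum is carried by the sites a perturbation reaches by time `s` (finite propagation speed in oscillator lattices [cite: ButtaEtAl2007, Thm 2.2] [cite: MarchioroEtAl1978]), so the dissipated norm is `O_t(1)·Z_N` while `‖g_N‖² ≍ N·Z_N`: "because there are sites that are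 of distance `∼ L` away from the nearest site with dissipation, a 'disturbance' at that site can not dissipate in a time smaller than `∝ L`" [cite: Znidaric2015, §IV.A]
evasions_known: (i) CORRELATIONS instead of norms: the open-system Green–Kubo formula `G = lim_{ΔT→0}⟨j̄⟩_{ΔT}/ΔT = (k_BT²)⁻¹∫₀^∞⟨j̄(t)j̄(0)⟩dt` integrates `⟨J, P_tJ⟩`, which may decay while `‖P_tJ‖` persists [cite: KunduDharNarayan2009, p. 3, the conductance formula ("the central result of the paper")]; (ii) integrate-then-norm at the cone scale (`‖∫₀^τ P_tJ dt‖²` grows like the light cone, `≍ N²` at `τ ∼ N`, not like `τ²N`) — the surviving crux `ConeScaleCorrector` of route `OddSectorIrreversibility`; (iii) rates measured on the transport/diffusive clock `t = N s`, `t = N² s` (the gap of a boundary-driven chain is at most `∼ 1/L` and typically `∼ 1/L³` [cite: Znidaric2015, §IV and §IV.A]; for the harmonic chain with friction at the two ends `λ_S ≍ N^{-3}`, and `O(N^{-1})` at most whenever the boundary frictions are bounded [cite: BeckerMenegaki2022, Thm 1 and Prop. 2.2 (3)]); (iv) boundary-LOCAL observables (supported within `O(1)` of a bath), for which `K(t)`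 and `M_N` are both `O(1)` and nothing here applies; (v) dissipation in the bulk: with the same non-zero friction at every oscillator the harmonic chain has an `N`-uniform spectral gap — "it is the sub-dimensionality of the particles experiencing friction that causes the spectral [gap] to close" [cite: BeckerMenegaki2022, Prop. 2.2 (2) and Remark 1] — the carré du champ is then extensive; (vi) "heat transport is an effect that is governed by all the modes of the system whereas the spectral gap is — in general — only determined by a single extremizing mode" [cite: BeckerMenegaki2022, §1.2]: the wall constrains norms of forecasts, not `κ`
scope_caveats: (a) equilibrium only (`T_L = T_R`): for `T_L ≠ T_R` the steady state is not explicit and neither the dissipation identity against it nor extensivity of variances is proved for anharmonic chains; (b) the Lean content is the generator identity (1) and the real-analysis implications; the integrated identity along `P_t`, contractivity, and the tap-locality input (2) are HYPOTHESES of the theorems (`of_dissipation_le`: `M_N - A_N(t) ≤ K(t) Z_N`), discharged in the tree only for `g = J_tot` (summit side, `OddCorrectorBathLocality.bathLocality`, via closeness to the closed-chain Koopman orbit rather than via tap norms) and for `g = H_N` (`of_slow` with `generator_hamiltonian_two_baths`); (c) the printed propagation bounds do NOT cover the conjunct's chain: [cite: ButtaEtAl2007, Thm 2.2] is for the infinite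 lattice with quartic pinning and HARMONIC nearest-neighbour coupling (Remark: couplings of degree at most half the pinning degree), Poisson brackets of bounded one-site observables, `ω`-almost surely for superstable invariant states, and [cite: MarchioroEtAl1978] for harmonic/bounded forces (`|i-j| > ct`) and `t^{4/3}` at equilibrium — the FPU-`β` coupling `r²/2 + βr⁴/4` of `pinnedChain` is outside both, so tap locality for a general local `g₀` there is expected, not printed; (d) `w ∈ L¹(0,∞)` weights are not blocked (such bounds hold by contractivity alone and carry no information), nor are `N`-dependent constants `C_N → ∞` or rates `λ_N → 0`; (e) [cite: Znidaric2015, §IV.A] is printed for boundary-dissipated quantum spin chains with bounded local Lindblad terms (Lieb–Robinson bounds), the classical oscillator version is the folklore transcription recorded here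
status: established (mechanism PROVED in Lean; transport-bound folklore in print [cite: Znidaric2015, §IV.A]; the locality input is a hypothesis, see scope_caveats (b)–(c))
[folklore] -/
def BoundaryTapNormPersistence (M : ℕ → ℝ) (A : ℕ → ℝ → ℝ) : Prop :=
  ∀ t : ℝ, 0 ≤ t → ∀ ε : ℝ, 0 < ε → ∀ᶠ N : ℕ in atTop, (1 - ε) * M N ≤ A N t

namespace BoundaryTapNormPersistence

variable {M : ℕ → ℝ} {A : ℕ → ℝ → ℝ}

/-- Unfolding the predicate. [folklore] -/
theorem iff_eventually :
    BoundaryTapNormPersistence M A ↔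
      ∀ t : ℝ, 0 ≤ t → ∀ ε : ℝ, 0 < ε → ∀ᶠ N : ℕ in atTop, (1 - ε) * M N ≤ A N t :=
  Iff.rfl

/-! #### How the wall arises -/

/-- **(1) + (2) ⟹ (3): dissipation identity + tap locality + extensivity give norm persistence.**
If the norm dissipated by time `t` is at most `K(t)·Z_N` (`M_N - A_N(t) ≤ K(t) Z_N`: the tap
dissipation identity `M_N - A_N(t) = 2γT∫₀ᵗ∑_b‖∂_{p_b}P_s g_N‖²ds` combined with an `N`-uniform
locality bound on the tap norms; `Z_N ≥ 0` the Gibbs mass) and the observable is extensive,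
`c N Z_N ≤ M_N` with `c > 0`, then `A_N(t) ≥ (1 - ε) M_N` as soon as `N ≥ K(t)/(εc)`. [folklore] -/
theorem of_dissipation_le {Z : ℕ → ℝ} {K : ℝ → ℝ} {c : ℝ} (hc : 0 < c) (hZ : ∀ N, 0 ≤ Z N)
    (hdiss : ∀ t, 0 ≤ t → ∀ N, M N - A N t ≤ K t * Z N)
    (hext : ∀ N : ℕ, c * N * Z N ≤ M N) :
    BoundaryTapNormPersistence M A := by
  intro t ht ε hε
  have hev : ∀ᶠ N : ℕ in atTop, K t / (ε * c) ≤ (N : ℝ) :=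
    tendsto_natCast_atTop_atTop.eventually_ge_atTop _
  filter_upwards [hev] with N hN
  have h1 : K t ≤ ε * c * N := by
    rw [div_le_iff₀ (by positivity)] at hN
    linarith
  have h2 : K t * Z N ≤ ε * c * N * Z N := mul_le_mul_of_nonneg_right h1 (hZ N)
  have h3 : ε * (c * N * Z N) ≤ ε * M N := mul_le_mul_of_nonneg_left (hext N) hε.le
  have h4 := hdiss t ht N
  have key : M N - A N t ≤ ε * M N := by linarith
  linarith

/-- **The even-sector route: a slowly moving extensive orbit is norm-persistent.** If
`‖P_t f_N‖ ≥ ‖f_N‖ - v t` (`t ≥ 0`; e.g. `v = ‖L f‖` for a contraction semigroup — for the centred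
energy `f_N = H_N - μ_T(H_N)` of ANY chain, `v = ‖L H_N‖_{L²(μ_T)} = 2γT` by
`generator_hamiltonian_two_baths`) and `‖f_N‖ ≥ σ√N` (`σ > 0`; `σ = T/√2` for the energy), then the
squared norms `M_N = ‖f_N‖²`, `A_N(t) = ‖P_t f_N‖²` are norm-persistent: this is the mechanism of the
companion entry `SpectralGapClosingEquilibrium.equilibrium_rate_bound`, now an instance of the wall.
[folklore] -/
theorem of_slow {m : ℕ → ℝ} {a : ℕ → ℝ → ℝ} {σ v : ℝ} (hσ : 0 < σ) (hv : 0 ≤ v)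
    (hm : ∀ N : ℕ, σ * Real.sqrt N ≤ m N)
    (hslow : ∀ N t, 0 ≤ t → m N - v * t ≤ a N t) :
    BoundaryTapNormPersistence (fun N => m N ^ 2) (fun N t => a N t ^ 2) := by
  intro t ht ε hε
  have hev : ∀ᶠ N : ℕ in atTop, (2 * v * t / (ε * σ)) ^ 2 ≤ (N : ℝ) :=
    tendsto_natCast_atTop_atTop.eventually_ge_atTop _
  filter_upwards [hev] with N hN
  have hsqrt : 2 * v * t / (ε * σ) ≤ Real.sqrt N := by
    have h := Real.sqrt_le_sqrt hN
    rwa [Real.sqrt_sq (by positivity)] at h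
  have h1 : 2 * v * t ≤ ε * σ * Real.sqrt N := by
    rw [div_le_iff₀ (by positivity)] at hsqrt
    linarith
  have h2 : 2 * v * t ≤ ε * m N := by
    have := mul_le_mul_of_nonneg_left (hm N) hε.le
    linarith
  have hm0 : 0 ≤ m N := le_trans (by positivity) (hm N)
  show (1 - ε) * m N ^ 2 ≤ a N t ^ 2
  by_cases hε1 : 1 ≤ ε
  · have : (1 - ε) * m N ^ 2 ≤ 0 := mul_nonpos_of_nonpos_of_nonneg (by linarith) (sq_nonneg _)
    linarith [sq_nonneg (a N t)]
  · push Not at hε1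
    have hεm : ε * m N ≤ m N := by nlinarith
    have hvt : v * t ≤ m N := by nlinarith [mul_nonneg hv ht]
    have h3 : m N - v * t ≤ a N t := hslow N t ht
    have h4 : 0 ≤ m N - v * t := by linarith
    have h5 : (m N - v * t) ^ 2 ≤ a N t ^ 2 := pow_le_pow_left₀ h4 h3 2
    nlinarith [h5, mul_le_mul_of_nonneg_right h2 hm0, sq_nonneg (v * t)]

/-! #### What the wall blocks -/

/-- **No `N`-uniform exponential norm decay.** If the family is norm-persistent and non-trivial
(`M_N > 0` for infinitely many `N`), then NO estimate `A_N(t) ≤ C e^{-λt} M_N` (`t ≥ 0`) with `λ > 0`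
and `(C, λ)` independent of `N` can hold — in terms of norms, no `‖P_t g_N‖ ≤ C' e^{-λ't} ‖g_N‖`
(`C = C'²`, `λ = 2λ'`): at the fixed time `t*` where `C e^{-λt*} ≤ 1/4` persistence keeps half of
`M_N` for large `N`. This is the `L²` form of "relaxation can not happen in a time that grows with
`L` slower than linearly" for boundary-dissipated chains [cite: Znidaric2015, §IV.A]. [folklore] -/
theorem not_exp_decay (h : BoundaryTapNormPersistence M A) (hM : ∃ᶠ N in atTop, 0 < M N)
    {C lam : ℝ} (hlam : 0 < lam)
    (hdecay : ∀ N t, 0 ≤ t → A N t ≤ C * Real.exp (-(lam * t)) * M N) : False := by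
  obtain ⟨t, ht, hCt⟩ : ∃ t : ℝ, 0 ≤ t ∧ C * Real.exp (-(lam * t)) ≤ 1 / 4 := by
    by_cases hC : C ≤ 0
    · exact ⟨0, le_rfl, by nlinarith [Real.exp_pos (-(lam * 0))]⟩
    · push Not at hC
      refine ⟨max 0 (Real.log (4 * C) / lam), le_max_left _ _, ?_⟩
      have h1 : Real.log (4 * C) / lam ≤ max 0 (Real.log (4 * C) / lam) := le_max_right _ _
      have h2 : Real.log (4 * C) ≤ lam * max 0 (Real.log (4 * C) / lam) := by
        rw [div_le_iff₀ hlam] at h1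
        linarith
      have h3 : Real.exp (-(lam * max 0 (Real.log (4 * C) / lam))) ≤
          Real.exp (-Real.log (4 * C)) := Real.exp_le_exp.2 (by linarith)
      have h3' : Real.exp (-Real.log (4 * C)) = (4 * C)⁻¹ := by
        rw [Real.exp_neg, Real.exp_log (by positivity)]
      rw [h3'] at h3
      calc C * Real.exp (-(lam * max 0 (Real.log (4 * C) / lam))) ≤ C * (4 * C)⁻¹ :=
            mul_le_mul_of_nonneg_left h3 hC.le
        _ = 1 / 4 := by field_simp
  obtain ⟨N, hMN, hAN⟩ := (hM.and_eventually (h t ht (1 / 2) (by norm_num))).exists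
  have hd := hdecay N t ht
  have h4 : C * Real.exp (-(lam * t)) * M N ≤ 1 / 4 * M N :=
    mul_le_mul_of_nonneg_right hCt hMN.le
  linarith

/-- **Core of the weighted bound, one length.** Let `w ≥ 0` be a weight, locally integrable, with
`∫_{(0,∞)} w(t) √(A(t)) dt ≤ C √M` (`M > 0`), where `A` does not increase on `(0, S]` past its value
at `S` (`A(S) ≤ A(t)`, contractivity) and a quarter of `M` survives at time `S` (`M ≤ 4 A(S)`). Then
`∫_{(0,S]} w ≤ 2C`: on `(0, S]`, `√A ≥ √M/2`. [folklore] -/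
theorem weightMass_le_core {A w : ℝ → ℝ} {M C S : ℝ} (hM : 0 < M)
    (hw : ∀ t, 0 ≤ w t) (hwi : IntegrableOn w (Ioc 0 S))
    (hint : IntegrableOn (fun t => w t * Real.sqrt (A t)) (Ioi 0))
    (hle : ∫ t in Ioi 0, w t * Real.sqrt (A t) ≤ C * Real.sqrt M)
    (hmono : ∀ t ∈ Ioc (0:ℝ) S, A S ≤ A t) (hmem : M ≤ 4 * A S) :
    ∫ t in Ioc 0 S, w t ≤ 2 * C := by
  have hsq : 0 < Real.sqrt M := Real.sqrt_pos.2 hM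
  have hlow : ∀ t ∈ Ioc (0:ℝ) S, Real.sqrt M / 2 ≤ Real.sqrt (A t) := by
    intro t ht
    have h1 : M / 4 ≤ A t := by linarith [hmono t ht]
    rw [Real.le_sqrt' (by positivity), div_pow, Real.sq_sqrt hM.le]
    norm_num
    linarith
  have hI0 : IntegrableOn (fun t => w t * Real.sqrt (A t)) (Ioc 0 S) :=
    hint.mono_set Ioc_subset_Ioi_self
  have hIc : IntegrableOn (fun t => w t * (Real.sqrt M / 2)) (Ioc 0 S) := hwi.mul_const _
  have h2 : ∫ t in Ioc 0 S, w t * (Real.sqrt M / 2) ≤ ∫ t in Ioc 0 S, w t * Real.sqrt (A t) :=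
    setIntegral_mono_on hIc hI0 measurableSet_Ioc fun t ht =>
      mul_le_mul_of_nonneg_left (hlow t ht) (hw t)
  have h3 : ∫ t in Ioc 0 S, w t * Real.sqrt (A t) ≤ ∫ t in Ioi 0, w t * Real.sqrt (A t) :=
    setIntegral_mono_set hint
      (Eventually.of_forall fun t => mul_nonneg (hw t) (Real.sqrt_nonneg _))
      Ioc_subset_Ioi_self.eventuallyLE
  have h4 : ∫ t in Ioc 0 S, w t * (Real.sqrt M / 2) = (∫ t in Ioc 0 S, w t) * (Real.sqrt M / 2) :=
    integral_mul_const _ _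
  have h5 : (∫ t in Ioc 0 S, w t) * (Real.sqrt M / 2) ≤ C * Real.sqrt M := by linarith
  by_contra hcon
  push Not at hcon
  have : C * Real.sqrt M < (∫ t in Ioc 0 S, w t) * (Real.sqrt M / 2) := by nlinarith
  linarith

/-- **No `N`-uniform weighted time-integrated norm decay beyond contractivity.** If the family is
norm-persistent, non-trivial, and contractive (`t ↦ A_N(t)` non-increasing on `[0,∞)` — `μ_T` is
`P_t`-invariant [cite: BonettoLebowitzReyBellet2000, §4.1]), then every `N`-UNIFORM bound
`∫₀^∞ w(t) ‖P_t g_N‖ dt ≤ C ‖g_N‖` with a weight `w ≥ 0` (stated on `√A_N = ‖P_t g_N‖`,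
`√M_N = ‖g_N‖`) forces `∫₀^S w ≤ 2C` for EVERY `S > 0`: the weight is integrable with mass `≤ 2C`,
so the bound is (up to the factor `2`) the trivial consequence `∫ w ‖P_t g‖ ≤ ‖w‖₁ ‖g‖` of
contractivity and carries no `N`-uniform decay information. [folklore] -/
theorem weightMass_le (h : BoundaryTapNormPersistence M A) (hM : ∃ᶠ N in atTop, 0 < M N)
    (hanti : ∀ N, AntitoneOn (A N) (Ici 0)) {w : ℝ → ℝ} (hw : ∀ t, 0 ≤ w t)
    (hwi : ∀ S, 0 < S → IntegrableOn w (Ioc 0 S)) {C : ℝ}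
    (hint : ∀ N, IntegrableOn (fun t => w t * Real.sqrt (A N t)) (Ioi 0))
    (hle : ∀ N, ∫ t in Ioi 0, w t * Real.sqrt (A N t) ≤ C * Real.sqrt (M N)) {S : ℝ}
    (hS : 0 < S) :
    ∫ t in Ioc 0 S, w t ≤ 2 * C := by
  obtain ⟨N, hMN, hAN⟩ := (hM.and_eventually (h S hS.le (3 / 4) (by norm_num))).exists
  refine weightMass_le_core hMN hw (hwi S hS) (hint N) (hle N) (fun t ht => ?_) (by linarith)
  exact hanti N (mem_Ici.2 ht.1.le) (mem_Ici.2 hS.le) ht.2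

/-- **In particular no `N`-uniform `L¹_t` norm decay** `∫₀^∞ ‖P_t g_N‖ dt ≤ C ‖g_N‖` (the shape of
the refuted support item `OddSectorIrreversibility.OddCorrectorDecay`, there with `g = J_tot` and the
momentum-odd part of the forecast): with `w ≡ 1`, `weightMass_le` gives `S ≤ 2C` for every `S`.
[folklore] -/
theorem not_L1_decay (h : BoundaryTapNormPersistence M A) (hM : ∃ᶠ N in atTop, 0 < M N)
    (hanti : ∀ N, AntitoneOn (A N) (Ici 0)) {C : ℝ}
    (hint : ∀ N, IntegrableOn (fun t => Real.sqrt (A N t)) (Ioi 0))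
    (hle : ∀ N, ∫ t in Ioi 0, Real.sqrt (A N t) ≤ C * Real.sqrt (M N)) : False := by
  have hS : (0:ℝ) < 2 * |C| + 1 := by positivity
  have key := weightMass_le (w := fun _ => (1:ℝ)) (C := C) h hM hanti (fun _ => zero_le_one)
    (fun S _ => (continuousOn_const.integrableOn_compact isCompact_Icc).mono_set
      Ioc_subset_Icc_self)
    (fun N => by simpa using hint N) (fun N => by simpa using hle N) hS
  have hval : ∫ _ in Ioc (0:ℝ) (2 * |C| + 1), (1:ℝ) = 2 * |C| + 1 := by
    rw [← intervalIntegral.integral_of_le hS.le, intervalIntegral.integral_const, smul_eq_mul,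
      mul_one, sub_zero]
  rw [hval] at key
  linarith [le_abs_self C]

/-! #### The packaged no-go statements -/

/-- **The barrier, packaged (exponential form; PROVED).** For a family of extensive observables of
the boundary-driven chain at equilibrium — tap dissipation + tap locality `M_N - A_N(t) ≤ K(t) Z_N`
(`Z_N ≥ 0`), extensivity `c N Z_N ≤ M_N` (`c > 0`), non-triviality (`M_N > 0` for infinitely many `N`)
— NO bound `A_N(t) ≤ C e^{-λt} M_N` (`t ≥ 0`) with `λ > 0` and `(C, λ)` independent of `N` holds.
[cite: Znidaric2015, §IV.A] [folklore] -/
theorem barrier {Z : ℕ → ℝ} {K : ℝ → ℝ} {c : ℝ} (hc : 0 < c) (hZ : ∀ N, 0 ≤ Z N)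
    (hdiss : ∀ t, 0 ≤ t → ∀ N, M N - A N t ≤ K t * Z N) (hext : ∀ N : ℕ, c * N * Z N ≤ M N)
    (hM : ∃ᶠ N in atTop, 0 < M N) {C lam : ℝ} (hlam : 0 < lam)
    (hdecay : ∀ N t, 0 ≤ t → A N t ≤ C * Real.exp (-(lam * t)) * M N) : False :=
  (of_dissipation_le hc hZ hdiss hext).not_exp_decay hM hlam hdecay

/-- **The barrier, packaged (`L¹_t` form; PROVED).** Under the same inputs plus contractivity
(`t ↦ A_N(t)` non-increasing on `[0,∞)`), NO bound `∫₀^∞ ‖P_t g_N‖ dt ≤ C ‖g_N‖` with `C`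
independent of `N` holds (`‖P_t g_N‖ = √A_N(t)`, `‖g_N‖ = √M_N`). [folklore] -/
theorem barrier_L1 {Z : ℕ → ℝ} {K : ℝ → ℝ} {c : ℝ} (hc : 0 < c) (hZ : ∀ N, 0 ≤ Z N)
    (hdiss : ∀ t, 0 ≤ t → ∀ N, M N - A N t ≤ K t * Z N) (hext : ∀ N : ℕ, c * N * Z N ≤ M N)
    (hM : ∃ᶠ N in atTop, 0 < M N) (hanti : ∀ N, AntitoneOn (A N) (Ici 0)) {C : ℝ}
    (hint : ∀ N, IntegrableOn (fun t => Real.sqrt (A N t)) (Ioi 0))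
    (hle : ∀ N, ∫ t in Ioi 0, Real.sqrt (A N t) ≤ C * Real.sqrt (M N)) : False :=
  (of_dissipation_le hc hZ hdiss hext).not_L1_decay hM hanti hint hle

end BoundaryTapNormPersistence

end Literature.Barriers.AtomisticToContinuum

end
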